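import Summits.BirchSwinnertonDyer.BirchSwinnertonDyer.Theorems.InertBadSignedBranchesInertBadAtThreeIstarZeroOfLowerHalf
import Summits.BirchSwinnertonDyer.BirchSwinnertonDyer.Theorems.InertBadSignedBranchesInertBadAtThreeGlue
import Summits.BirchSwinnertonDyer.Rank1Residual.X12.InertBadLocalTypesThree
import HarnessLib

/-!
# Route `InertBadSignedBranches` (rung K8), D71 child `InertBadAtThreeOffIstarZero` (stmt-BirchSwinnertonDyer-19657,
# HELD residual): the SHAPE of the off-type corner at `3` and its open content IN THE KERNEL —
# the child ⟺ the typed lower halves on the two signed types `(3, III)`, `(3, III*)`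
# (helper `--supports` 19657; cell bsd-cm, seat bsd-cm-k8i-c42 g0; nothing asserted)

The item (planner D71, child 2 of `InertBadAtThree`): for every globally minimal CM curve `W/ℚ` of
analytic rank one with `3` INERT in the CM field, BAD at `3` and NOT of signed local type `(3, I₀*)`,
the typed missing input `Typed.X12.MissingInputAt W 3` (= `MissingPPartAt W 3`: `ord₃ #Ш(W)_an =
ord₃ #Ш(W)`). It is HELD as a CONSTRUCTION (no twist of such a `W` has good reduction at `3`; the
rank-one link is Perrin-Riou's conjecture for `f_W` at its supercuspidal prime `3` — cell memos N13 /
N15 / N18). THIS FILE does not attack it. It records, from the tree's X12 theorems (cell `b2b-bsdres`,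
x1b gens 12/22/24, harvest), three pieces of bookkeeping that make the residual's content precise:

* §1 **SHAPE.** The item's four hypotheses (CM ∧ `3` inert ∧ bad ∧ ¬`(3, I₀*)`) hold iff `W` has
  signed local type `(3, III)` or `(3, III*)`; either way `j(W) = 1728` (x1b's Kodaira classification
  at the place over `3`, `hasGoodReductionAt_or_kodairaSymbolAt_of_hasCM_three`, + the uniqueness of
  the place of `ℚ` over `3`). So O10-SC@3 = the quartic twists `y² = x³ + Ax`, `v₃(A)` odd — the two
  signed types `(3, III)` (48 census classes) and `(3, III*)` (49), `e = 4 = 3 + 1`.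
* §2 **PER PAIR** the child's conclusion ⟸ the pair's OWN lower half `MissingLowerBoundAt W 3` + the
  eight published facts of the upper half at `3` + a parametrisation datum with `3 ∤ c(D)`
  (x1b/harvest `X12.bsdp_three_of_classX12_of_bad_of_lower'`: Kolyvagin in Matar–Nekovář's irreducible
  form over a Friedberg–Hoffstein field, the CM rank-zero triple for the twist, GZK, modularity; the
  Tamagawa datum discharged for every CM field `≠ ℚ(√−3)`) — the upper half is TYPE-BLIND at `3`;
  and ⟸ a CERTIFIED `3`-adic unit `#Ш(W)_an` (route T-KR@3; 94/97 O10-SC@3 classes `N < 5·10⁵` per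
  pair, the other three wait on an optimality/Manin datum, memo N18 v1.2).
* §3 **CLASS LEVEL: modulo the eight facts and the Manin datum on the class,
  `InertBadAtThreeOffIstarZero` ⟺ `X12.O10.LowerHalfOnType 3 III ∧ X12.O10.LowerHalfOnType 3 III*`**
  (`⇒` is unconditional bookkeeping). The twin of the `(3, I₀*)` child's normal form
  (`InertBadOddLowerHalf.inertBadAtThreeIstarZero_of_lowerHalfOnType_three`, inert g11 p416932).
* §4 **THE PARENT.** With the landed glue (p410049) and the `I₀*` twin: `InertBadAtThree` (19225) ⟸
  the three typed lower halves `LowerHalfOnType 3 T`, `T ∈ {I₀*, III, III*}` + facts + Manin@3 — the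
  whole open content of K12i@3 (154 census classes) is the main-conjecture half of `BSD₃` on three
  signed local types plus the Manin datum at an additive `3` (no Mazur — `9 ∣ N`; no Edixhoven —
  `3 ≤ 7`).

HONEST LABEL: CONDITIONAL on displayed hypotheses; `LowerHalfOnType 3 III / III*` are the OPEN class
targets (CONSTRUCTION: `(GZ_t)` at `(e, p) = (4, 3)`, memos N13 §6 / N15 §4 / N18 §4); nothing is
booked; no label moves; 19657 stays HELD, O10@3 OPEN at class level. What this is NOT: not a proof of
any lower half; no new typed input; no Literature statement, no named fact minted; the residual is
not restated (§3 is an equivalence with EXISTING typed class targets).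
[cite: SilvermanATAEC1994, IV.9.4 and Table 4.1] [cite: MatarNekovar2019, Thm. 0.3 and §0.11]
[cite: Miller2011LMS, §1 and Def. 1.1] [cite: BurungaleFlach2024, Thm. 1.1 and Cor. 2]
-/

set_option autoImplicit false
set_option linter.dupNamespace false

noncomputable section

open scoped Classical NumberField

open WeierstrassCurve NumberField IsDedekindDomain
open Literature.NumberTheory.EllipticCurves
open Literature.NumberTheory.EllipticCurves.ModularForms
open Literature.NumberTheory.EllipticCurves.Rank1Residual
open Literature.NumberTheory.EllipticCurves.Rank1Residual.Typed
open Literature.NumberTheory.DiophantineGeometry (KodairaSymbol)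
open Summit.BirchSwinnertonDyer.Rank1Residual
open Summit.BirchSwinnertonDyer.Rank1Residual.X12.O10
open Summit.BirchSwinnertonDyer.BirchSwinnertonDyer.Theses.InertBadSignedBranches

namespace Summit.BirchSwinnertonDyer.BirchSwinnertonDyer.Theorems.InertBadOffLowerHalf

/-! ## §0 The place of `ℚ` over `3` (exists, and is unique) -/

/-- There is a place of `ℚ` over `3` (Mathlib's `Rat.HeightOneSpectrum.primesEquiv`). [folklore] -/
theorem exists_place_three :
    ∃ v : HeightOneSpectrum (𝓞 ℚ), Rat.HeightOneSpectrum.natGenerator v = 3 :=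
  ⟨(Rat.HeightOneSpectrum.primesEquiv (R := 𝓞 ℚ)).symm ⟨3, Nat.prime_three⟩,
    congrArg Subtype.val
      ((Rat.HeightOneSpectrum.primesEquiv (R := 𝓞 ℚ)).apply_symm_apply ⟨3, Nat.prime_three⟩)⟩

/-- Two places of `ℚ` over the same prime coincide. [folklore] -/
theorem place_eq_of_natGenerator_eq {v w : HeightOneSpectrum (𝓞 ℚ)}
    (h : Rat.HeightOneSpectrum.natGenerator v = Rat.HeightOneSpectrum.natGenerator w) : v = w :=
  (Rat.HeightOneSpectrum.primesEquiv (R := 𝓞 ℚ)).injective (Subtype.ext h)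

/-- A signed local type at `3` is read off ANY (= the one) place over `3`. Bookkeeping. [folklore] -/
theorem hasSignedLocalType_three_iff (W : WeierstrassCurve ℚ) [W.IsElliptic] [Fact (Nat.Prime 3)]
    (T : KodairaSymbol) (v : HeightOneSpectrum (𝓞 ℚ)) (hv : Rat.HeightOneSpectrum.natGenerator v = 3) :
    HasSignedLocalType W 3 T ↔ W.HasCM ∧ CMInert W 3 ∧ ¬ Good W 3 ∧ W.kodairaSymbolAt v = T := by
  refine ⟨fun ⟨hCM, hin, hbad, hk⟩ ↦ ⟨hCM, hin, hbad, hk v hv⟩,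
    fun ⟨hCM, hin, hbad, hk⟩ ↦ ⟨hCM, hin, hbad, fun w hw ↦ ?_⟩⟩
  rw [place_eq_of_natGenerator_eq (hw.trans hv.symm), hk]

/-! ## §1 SHAPE of the off-type corner at `3`: `j = 1728`, signed type `(3, III)` or `(3, III*)` -/

/-- **The off-`I₀*` inert-bad corner at `3` is `(3, III) ⊔ (3, III*)`, and `j = 1728` there.** For a CM
curve `W/ℚ` with `3` inert in the CM field (`K ≠ ℚ(√−3)`, so x1b's classification at the place over
`3` applies: good, or `j = 1728` with type `III / I₀* / III*`, or `j ∉ {0, 1728}` with type `I₀*`), BAD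
at `3` and NOT of signed local type `(3, I₀*)`: `j(W) = 1728` and the signed local type is `(3, III)`
or `(3, III*)` — the quartic twists `y² = x³ + Ax` with `v₃(A) ≡ 1, 3 (mod 4)` (O10-SC@3; 48 + 49
census classes, memo N18). [cite: SilvermanATAEC1994, IV.9.4, Table 4.1 and App. A §3] -/
theorem j_eq_1728_and_hasSignedLocalType_of_offIstarZero (W : WeierstrassCurve ℚ) [W.IsElliptic]
    [Fact (Nat.Prime 3)] (hCM : W.HasCM) (hin : CMInert W 3) (hbad : ¬ Good W 3)
    (hnT : ¬ HasSignedLocalType W 3 (.Istar 0)) :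
    W.j = 1728 ∧ (HasSignedLocalType W 3 .III ∨ HasSignedLocalType W 3 .IIIstar) := by
  obtain ⟨v, hv⟩ := exists_place_three
  have hbad' : ¬ W.HasGoodReductionAt v := by
    rwa [← X12.good_iff_hasGoodReductionAt W 3 v hv]
  have hne : W.kodairaSymbolAt v ≠ .Istar 0 := fun h ↦
    hnT ((hasSignedLocalType_three_iff W _ v hv).mpr ⟨hCM, hin, hbad, h⟩)
  rcases X12.hasGoodReductionAt_or_kodairaSymbolAt_of_hasCM_three W hCM v hv hin.1 with
      h | ⟨hj, hk⟩ | ⟨-, -, hk⟩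
  · exact absurd h hbad'
  · refine ⟨hj, ?_⟩
    rcases hk with hk | hk | hk
    · exact Or.inl ((hasSignedLocalType_three_iff W _ v hv).mpr ⟨hCM, hin, hbad, hk⟩)
    · exact absurd hk hne
    · exact Or.inr ((hasSignedLocalType_three_iff W _ v hv).mpr ⟨hCM, hin, hbad, hk⟩)
  · exact absurd hk hne

/-- Conversely a curve of signed type `(3, III)` satisfies the item's four hypotheses (the Kodaira
symbol at the place over `3` is `III ≠ I₀*`). Bookkeeping. [cite: SilvermanATAEC1994, IV.9.4 and Table 4.1] -/
theorem offIstarZero_of_hasSignedLocalType_III (W : WeierstrassCurve ℚ) [W.IsElliptic]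
    [Fact (Nat.Prime 3)] (hT : HasSignedLocalType W 3 .III) :
    W.HasCM ∧ CMInert W 3 ∧ ¬ Good W 3 ∧ ¬ HasSignedLocalType W 3 (.Istar 0) := by
  obtain ⟨v, hv⟩ := exists_place_three
  obtain ⟨hCM, hin, hbad, hk⟩ := (hasSignedLocalType_three_iff W _ v hv).mp hT
  refine ⟨hCM, hin, hbad, fun h ↦ ?_⟩
  have hk' := ((hasSignedLocalType_three_iff W _ v hv).mp h).2.2.2
  rw [hk] at hk'
  exact absurd hk' (by decide)

/-- … and likewise for the signed type `(3, III*)`. Bookkeeping. [cite: SilvermanATAEC1994, IV.9.4 and Table 4.1] -/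
theorem offIstarZero_of_hasSignedLocalType_IIIstar (W : WeierstrassCurve ℚ) [W.IsElliptic]
    [Fact (Nat.Prime 3)] (hT : HasSignedLocalType W 3 .IIIstar) :
    W.HasCM ∧ CMInert W 3 ∧ ¬ Good W 3 ∧ ¬ HasSignedLocalType W 3 (.Istar 0) := by
  obtain ⟨v, hv⟩ := exists_place_three
  obtain ⟨hCM, hin, hbad, hk⟩ := (hasSignedLocalType_three_iff W _ v hv).mp hT
  refine ⟨hCM, hin, hbad, fun h ↦ ?_⟩
  have hk' := ((hasSignedLocalType_three_iff W _ v hv).mp h).2.2.2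
  rw [hk] at hk'
  exact absurd hk' (by decide)

/-- **The SHAPE as an `iff`**: the item's hypotheses ⟺ signed type `(3, III)` or `(3, III*)`.
[cite: SilvermanATAEC1994, IV.9.4, Table 4.1 and App. A §3] -/
theorem offIstarZero_iff_hasSignedLocalType_III_or_IIIstar (W : WeierstrassCurve ℚ) [W.IsElliptic]
    [Fact (Nat.Prime 3)] :
    (W.HasCM ∧ CMInert W 3 ∧ ¬ Good W 3 ∧ ¬ HasSignedLocalType W 3 (.Istar 0)) ↔
      (HasSignedLocalType W 3 .III ∨ HasSignedLocalType W 3 .IIIstar) :=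
  ⟨fun ⟨hCM, hin, hbad, hnT⟩ ↦
      (j_eq_1728_and_hasSignedLocalType_of_offIstarZero W hCM hin hbad hnT).2,
    fun h ↦ h.elim (offIstarZero_of_hasSignedLocalType_III W)
      (offIstarZero_of_hasSignedLocalType_IIIstar W)⟩

/-! ## §2–§4 need the PUBLISHED named facts of the upper half at `3` (exactly those of
`X12/CMTamagawaThreeAll.lean` §3 and of the `I₀*` twin p416932). -/

section Facts

variable
  (hGZ : ∀ (N : ℕ) [NeZero N] (W : WeierstrassCurve ℚ) (K : Type) [Field K] [NumberField K],
    gross_zagier N W K)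
  (hKo : ∀ (N : ℕ) [NeZero N] (W : WeierstrassCurve ℚ) (K : Type) [Field K] [NumberField K],
    kolyvagin N W K)
  (hMN : ∀ (N : ℕ) [NeZero N] (W : WeierstrassCurve ℚ) (K : Type) [Field K] [NumberField K],
    MatarNekovar2019.thm03_padicValNat_card_sha_le_of_irreducible N W K)
  (hGZK : rank_eq_analyticRank_of_analyticRank_le_one) (hmod : hasEntireLFunction_rat)
  (hnf : exists_isNewformOf) (hFH : friedbergHoffstein_exists_heegnerField_split_twist_ne_zero)
  (hCM8 : bsdTriple_of_hasCM_of_L_one_ne_zero)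

include hGZ hKo hMN hGZK hmod hnf hFH hCM8

/-! ## §2 Per pair on the off-type corner at `3` (the upper half at `3` is type-blind) -/

/-- **`BSD(W, 3)` at a pair of the off-`I₀*` corner from the pair's OWN lower half and the Manin
datum** — x1b/harvest's `X12.bsdp_three_of_classX12_of_bad_of_lower'` keyed by the item's hypotheses
(`ClassX12 W 3` from CM + `r_an = 1` + bad; `3 ∤ d_K` from `CMInert`). CONDITIONAL; nothing booked.
[cite: MatarNekovar2019, Thm. 0.3 and §0.11] [cite: Miller2011LMS, §1 and Def. 1.1] -/
theorem bsdp_three_offIstarZero_of_lower (W : WeierstrassCurve ℚ) [W.IsElliptic]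
    [W.IsGloballyMinimal] [Fact (Nat.Prime 3)] [NeZero (W.conductorNorm ℤ)]
    (hCM : W.HasCM) (hr : W.analyticRank = 1) (hin : CMInert W 3) (hbad : ¬ Good W 3)
    (D : ModularParametrizationData W (W.conductorNorm ℤ)) (hc : ¬ (3 : ℤ) ∣ D.c)
    (hlow : MissingLowerBoundAt W 3) : BSDp W 3 :=
  X12.bsdp_three_of_classX12_of_bad_of_lower' hGZ hKo hMN hGZK hmod hnf hFH hCM8 W
    ⟨hCM, hr, Or.inr (Or.inr (Or.inr hbad))⟩ hbad hin.1 D hc hlow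

/-- **The child's conclusion `Typed.X12.MissingInputAt W 3` at a pair of the off-`I₀*` corner ⟸ the
pair's lower half + the Manin datum + the eight published facts** (the hypothesis `¬ (3, I₀*)` is
not even needed: the upper half at `3` is type-blind). CONDITIONAL; nothing booked.
[cite: MatarNekovar2019, Thm. 0.3 and §0.11] [cite: Miller2011LMS, §1 and Def. 1.1] -/
theorem missingInputAt_three_offIstarZero_of_lower (W : WeierstrassCurve ℚ) [W.IsElliptic]
    [W.IsGloballyMinimal] [Fact (Nat.Prime 3)] [NeZero (W.conductorNorm ℤ)]
    (hCM : W.HasCM) (hr : W.analyticRank = 1) (hin : CMInert W 3) (hbad : ¬ Good W 3)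
    (D : ModularParametrizationData W (W.conductorNorm ℤ)) (hc : ¬ (3 : ℤ) ∣ D.c)
    (hlow : MissingLowerBoundAt W 3) : X12.MissingInputAt W 3 := by
  have hB := bsdp_three_offIstarZero_of_lower hGZ hKo hMN hGZK hmod hnf hFH hCM8 W hCM hr hin hbad
    D hc hlow
  haveI : Finite W.sha := (hGZK W (by rw [hr])).2
  exact fun _ ↦ missingPPartAt_of_bsdp W 3 hB

/-- **Route T-KR@3 keyed by the item's hypotheses: `Typed.X12.MissingInputAt W 3` ⟸ a CERTIFIED
`3`-adic unit `#Ш(W)_an`** (+ the Manin datum + the eight facts) — the per-pair lever that closes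
94 of the 97 O10-SC@3 census classes (memo N18 v1.2 §4; the other three, `484128cc1/cd1/e1`, wait on
an optimality/Manin datum only). PER PAIR; CONDITIONAL; nothing booked.
[cite: MatarNekovar2019, Thm. 0.3 and §0.11] [cite: Miller2011LMS, §1 and Def. 1.1] -/
theorem missingInputAt_three_offIstarZero_of_shaAn_unit (W : WeierstrassCurve ℚ) [W.IsElliptic]
    [W.IsGloballyMinimal] [Fact (Nat.Prime 3)] [NeZero (W.conductorNorm ℤ)]
    (hCM : W.HasCM) (hr : W.analyticRank = 1) (hin : CMInert W 3) (hbad : ¬ Good W 3)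
    (D : ModularParametrizationData W (W.conductorNorm ℤ)) (hc : ¬ (3 : ℤ) ∣ D.c)
    {q : ℚ} (hq : shaAn W = (q : ℂ)) (hv : padicValRat 3 q = 0) : X12.MissingInputAt W 3 := by
  have hB := X12.bsdp_three_of_classX12_of_bad_of_shaAn_unit' hGZ hKo hMN hGZK hmod hnf hFH hCM8 W
    ⟨hCM, hr, Or.inr (Or.inr (Or.inr hbad))⟩ hbad hin.1 D hc hq hv
  haveI : Finite W.sha := (hGZK W (by rw [hr])).2
  exact fun _ ↦ missingPPartAt_of_bsdp W 3 hB

/-! ## §3 Class level: the child ⟺ the typed lower halves on `(3, III)` and `(3, III*)` -/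

/-- **`InertBadAtThreeOffIstarZero` (19657) ⟸ `X12.O10.LowerHalfOnType 3 III` ∧
`X12.O10.LowerHalfOnType 3 III*` + the eight published facts + the Manin datum on the corner**
(`hManin`: every rank-one `W` of the off-`I₀*` corner at `3` has a parametrisation datum at the
conductor level with `3 ∤ c(D)` — per pair Cremona's table / Agashe–Ribet–Stein to `N ≤ 130000`; no
class-level theorem at an additive `3`). So the HELD residual's open content is the main-conjecture
half of `BSD₃` on the two signed types of semistability defect `e = 4` at `3` and that datum.
CONDITIONAL; nothing booked; 19657 stays HELD, O10@3 OPEN at class level.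
[cite: MatarNekovar2019, Thm. 0.3 and §0.11] [cite: Miller2011LMS, §1 and Def. 1.1]
[cite: SilvermanATAEC1994, IV.9.4 and Table 4.1] -/
theorem inertBadAtThreeOffIstarZero_of_lowerHalfOnType_three
    (hManin : ∀ (W : WeierstrassCurve ℚ) [W.IsElliptic] [W.IsGloballyMinimal] [Fact (Nat.Prime 3)]
      [NeZero (W.conductorNorm ℤ)], W.HasCM → W.analyticRank = 1 → CMInert W 3 → ¬ Good W 3 →
      ¬ HasSignedLocalType W 3 (.Istar 0) →
      ∃ D : ModularParametrizationData W (W.conductorNorm ℤ), ¬ (3 : ℤ) ∣ D.c)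
    (hIII : LowerHalfOnType 3 .III) (hIIIstar : LowerHalfOnType 3 .IIIstar) :
    InertBadAtThreeOffIstarZero := by
  unfold InertBadAtThreeOffIstarZero
  intro W _ _ _ hCM hr hin hbad hnT
  haveI : NeZero (W.conductorNorm ℤ) := ⟨(W.conductorNorm_pos_holds).ne'⟩
  obtain ⟨D, hc⟩ := hManin W hCM hr hin hbad hnT
  have hlow : MissingLowerBoundAt W 3 := by
    rcases (j_eq_1728_and_hasSignedLocalType_of_offIstarZero W hCM hin hbad hnT).2 with hT | hT
    · exact hIII W hT hr
    · exact hIIIstar W hT hr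
  exact missingInputAt_three_offIstarZero_of_lower hGZ hKo hMN hGZK hmod hnf hFH hCM8 W hCM hr hin
    hbad D hc hlow

omit hGZ hKo hMN hGZK hmod hnf hFH hCM8 in
/-- **Conversely (UNCONDITIONAL bookkeeping): `InertBadAtThreeOffIstarZero` ⟹ the typed lower halves
on `(3, III)` and `(3, III*)`** — a curve of either type satisfies the item's hypotheses (§1), its
typed input is `MissingPPartAt W 3` (`3` is not split in the CM field), whose lower half is read off.
So, modulo the eight facts and the Manin datum, the residual is EXACTLY
`LowerHalfOnType 3 III ∧ LowerHalfOnType 3 III*` — neither weaker nor stronger.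
[cite: Miller2011LMS, §1 and Def. 1.1] [cite: SilvermanATAEC1994, IV.9.4 and Table 4.1] -/
theorem lowerHalfOnType_three_of_inertBadAtThreeOffIstarZero (h : InertBadAtThreeOffIstarZero) :
    LowerHalfOnType 3 .III ∧ LowerHalfOnType 3 .IIIstar := by
  haveI : Fact (Nat.Prime 3) := ⟨Nat.prime_three⟩
  have key : ∀ (W : WeierstrassCurve ℚ) [W.IsElliptic] [W.IsGloballyMinimal],
      (W.HasCM ∧ CMInert W 3 ∧ ¬ Good W 3 ∧ ¬ HasSignedLocalType W 3 (.Istar 0)) →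
      W.analyticRank = 1 → MissingLowerBoundAt W 3 := by
    intro W _ _ ⟨hCM, hin, hbad, hnT⟩ hr
    have hmiss : X12.MissingInputAt W 3 := h W hCM hr hin hbad hnT
    have hP : MissingPPartAt W 3 := hmiss (fun hs ↦ hin.2 hs.2)
    exact (lower_and_upper_of_missingPPartAt W 3 hP).1
  exact ⟨fun W _ _ hT hr ↦ key W (offIstarZero_of_hasSignedLocalType_III W hT) hr,
    fun W _ _ hT hr ↦ key W (offIstarZero_of_hasSignedLocalType_IIIstar W hT) hr⟩

/-- **The residual as an `iff`** (modulo the eight published facts and the Manin datum on the corner):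
`InertBadAtThreeOffIstarZero ⟺ LowerHalfOnType 3 III ∧ LowerHalfOnType 3 III*`.
CONDITIONAL; nothing booked. [cite: MatarNekovar2019, Thm. 0.3 and §0.11] [cite: Miller2011LMS, §1 and Def. 1.1] -/
theorem inertBadAtThreeOffIstarZero_iff_lowerHalfOnType_three
    (hManin : ∀ (W : WeierstrassCurve ℚ) [W.IsElliptic] [W.IsGloballyMinimal] [Fact (Nat.Prime 3)]
      [NeZero (W.conductorNorm ℤ)], W.HasCM → W.analyticRank = 1 → CMInert W 3 → ¬ Good W 3 →
      ¬ HasSignedLocalType W 3 (.Istar 0) →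
      ∃ D : ModularParametrizationData W (W.conductorNorm ℤ), ¬ (3 : ℤ) ∣ D.c) :
    InertBadAtThreeOffIstarZero ↔ (LowerHalfOnType 3 .III ∧ LowerHalfOnType 3 .IIIstar) :=
  ⟨lowerHalfOnType_three_of_inertBadAtThreeOffIstarZero,
    fun h ↦ inertBadAtThreeOffIstarZero_of_lowerHalfOnType_three hGZ hKo hMN hGZK hmod hnf hFH hCM8
      hManin h.1 h.2⟩

/-! ## §4 The parent `InertBadAtThree` (19225) from the three typed lower halves at `3` -/

/-- **`InertBadAtThree` (the whole `p = 3` residual of rung K8, 154 census classes) ⟸ the three typed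
lower halves `LowerHalfOnType 3 T`, `T ∈ {I₀*, III, III*}` + the eight published facts + the Manin
datum on K12i@3** — by the landed glue (D71, p410049: children ⟹ parent), the `(3, I₀*)` child's
normal form (inert g11, p416932) and §3. The Manin binder is stated once for the whole inert-bad
corner at `3` (CM, `r_an = 1`, `3` inert, bad) and specialised to each child. CONDITIONAL; nothing
booked; 19225 / 19656 / 19657 and O10@3 stay OPEN (resp. HELD) at class level.
[cite: MatarNekovar2019, Thm. 0.3 and §0.11] [cite: Miller2011LMS, §1 and Def. 1.1]
[cite: SilvermanATAEC1994, IV.9.4 and Table 4.1] -/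
theorem inertBadAtThree_of_lowerHalfOnTypes_three
    (hManin : ∀ (W : WeierstrassCurve ℚ) [W.IsElliptic] [W.IsGloballyMinimal] [Fact (Nat.Prime 3)]
      [NeZero (W.conductorNorm ℤ)], W.HasCM → W.analyticRank = 1 → CMInert W 3 → ¬ Good W 3 →
      ∃ D : ModularParametrizationData W (W.conductorNorm ℤ), ¬ (3 : ℤ) ∣ D.c)
    (hI0 : LowerHalfOnType 3 (.Istar 0)) (hIII : LowerHalfOnType 3 .III)
    (hIIIstar : LowerHalfOnType 3 .IIIstar) : InertBadAtThree :=
  inertBadSignedBranches_inertBadAtThreeGlue_proof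
    (InertBadOddLowerHalf.inertBadAtThreeIstarZero_of_lowerHalfOnType_three hGZ hKo hMN hGZK hmod hnf
      hFH hCM8 (fun W _ _ _ _ hT hr ↦ hManin W hT.1 hr hT.2.1 hT.2.2.1) hI0)
    (inertBadAtThreeOffIstarZero_of_lowerHalfOnType_three hGZ hKo hMN hGZK hmod hnf hFH hCM8
      (fun W _ _ _ _ hCM hr hin hbad _ ↦ hManin W hCM hr hin hbad) hIII hIIIstar)

end Facts

end Summit.BirchSwinnertonDyer.BirchSwinnertonDyer.Theorems.InertBadOffLowerHalf

end
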